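import Literature.Probability.Percolation.CerfCentralInequality
import Literature.Probability.Percolation.CerfLem71Proofs
import Literature.Probability.Percolation.SiteMonotonicity
import Mathlib.Algebra.Order.Chebyshev
import Mathlib.MeasureTheory.Function.SpecialFunctions.Basic
import HarnessLib

/-!
# Cerf 2015, Lemma 5.1 (the central inequality): proof from Proposition 4.1

Topic `Literature/Probability/Percolation`. Sorry-free proof of
`Cerf2015_prop_4_1 → Cerf2015_lem_5_1` (`CerfCentralInequality.lean`): the counting argument
of Aizenman–Kesten–Newman / Gandolfi–Grimmett–Russo as run by R. Cerf, *A lower bound on the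
two-arms exponent for critical percolation on the lattice*, Ann. Probab. 43 (2015) 2458–2480,
arXiv:1306.3105, §3 (p. 6) and §5 (p. 9), for the repaired collection `𝒞` of clusters of
`L = Λ(n+ℓ)` meeting `Λ(n+1)` and `∂ⁱⁿL` (module docstring of `CerfCentralInequality.lean`).

## The argument, as formalised

For `ω` fixed write `𝒞 = reachingClusters G L Λ(n+1) ω`, and for `C ∈ 𝒞` let
`K_C = |C̄ ∩ Λ(n)|`, `O_C = |C ∩ Λ(n)|`, `h_C = h(C̄ ∩ Λ(n))`; for `x ∈ Λ(n)` let
`m_x = #{C ∈ 𝒞 : x ∈ C̄}`. Cerf's sets are `F = {x open, C(x) ∈ 𝒞}`,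
`G = {x closed, m_x ≥ 1}`, `H = {x closed, m_x ≥ 2}` (p. 6).
* *Counting* (§3): `𝟙_H(x) + 𝟙_G(x) ≤ 𝟙[x closed] m_x`, and
  `Σ_x 𝟙[x closed] m_x = Σ_C (K_C − O_C)`, `Σ_x #{C ∈ 𝒞 : x ∈ C} = Σ_C O_C`,
  `(K_C − O_C) − ((1−p)/p) O_C = (1−p) h_C`; so
  `|H| + |G| − ((1−p)/p)|F| ≤ (1−p) Σ_C h_C ≤ (1−p) Σ_C |h_C|` pointwise
  (`counting_le`).
* *§5*: `Σ_C K_C = Σ_x m_x ≤ 2d |Λ(n)|` (a closed site is adjacent to at most `2d` clusters, an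
  open one lies in one), `|h_C| ≤ K_C/(p(1−p))`, and on
  `ℰ = {∀ C ∈ 𝒞, K_C = 0 ∨ |h_C| < (ln n)√K_C}` Cauchy–Schwarz gives
  `Σ_C |h_C| ≤ (ln n) √|𝒞| √(2d|Λ(n)|)`; hence
  `Σ_C |h_C| ≤ (ln n)√(2d|Λ(n)|)√|𝒞| + (2d|Λ(n)|/(p(1−p))) 𝟙_{ℰᶜ}` (`sum_abs_cerfH_le`).
* *Probability*: `P(x ∈ G) = (1−p) P(N_x)`, `P(x ∈ F) = p P(N_x)` with
  `N_x = {a neighbour of x is joined to ∂ⁱⁿL off x}` independent of the state of `x`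
  (`real_closed_inter_eq`, `real_open_inter_eq`), so the `F` and `G` terms cancel in
  expectation; `P(ℰᶜ) ≤ |Λ(n+1)| |Λ(n)| 2e^{−2p²(1−p)²(ln n)²}` by Prop. 4.1 and a union bound
  (`real_bad_le`); and `two-arms(x, 2n+ℓ) ⊆ {x ∈ H}` for `x ∈ Λ(n)`
  (`siteTwoArms_subset_H`) with `P(two-arms(x,·)) = P(two-arms(0,·))`. Integrating the
  pointwise inequality gives `|Λ(n)| P(two-arms(0,2n+ℓ)) ≤ (1−p)(ln n)√(2d|Λ(n)|) E√|𝒞| +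
  (2d|Λ(n)|/p) P(ℰᶜ)`, which implies the vendored bound.

## Main result

* `Cerf2015_lem_5_1_of_prop_4_1 : Cerf2015_prop_4_1 → Cerf2015_lem_5_1`.
-/

noncomputable section

open MeasureTheory Filter Topology Literature.Probability.LatticeModels Literature.Probability.Percolation

namespace Literature.Probability.Percolation

section CritPerc

variable {V : Type*} {d : ℕ}

/-! ### Clusters and the collection `𝒞` -/

section ClusterFamily

variable {G : SimpleGraph V}

/-- Two sites of the same restricted cluster have the same restricted cluster (a public copy
now lives in `CerfCor72Proofs.lean`; kept private here to avoid the import). [folklore] -/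
private theorem siteClusterIn_eq_of_mem {S : Set V} {ω : SiteConfig V} {x y : V}
    (h : y ∈ siteClusterIn G S ω x) : siteClusterIn G S ω y = siteClusterIn G S ω x := by
  ext t
  simp only [mem_siteClusterIn_iff]
  constructor
  · intro ht
    exact siteConnIn_trans G subset_rfl subset_rfl h ht
  · intro ht
    have h' : ω ∈ siteConnIn G S y x := by rw [siteConnIn_comm]; exact h
    exact siteConnIn_trans G subset_rfl subset_rfl h' ht

variable [DecidableEq V] [G.LocallyFinite] [DecidableRel G.Adj]

omit [DecidableRel G.Adj] in
open Classical in
/-- A member of `𝒞` is the (finite) restricted cluster of each of its sites, and reaches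
`∂ⁱⁿ L`. [cite: Cerf2015, §2–§3] -/
theorem eq_filter_of_mem_reachingClusters {L Λ : Finset V} {ω : SiteConfig V} {C : Finset V}
    (hC : C ∈ reachingClusters G L Λ ω) {v : V} (hv : v ∈ C) :
    C = L.filter (fun y => y ∈ siteClusterIn G ↑L ω v) ∧
      ∃ w ∈ innerBoundary G L, w ∈ siteClusterIn G ↑L ω v := by
  obtain ⟨x, -, hreach, rfl⟩ := mem_reachingClusters_iff.1 hC
  have hv' : v ∈ siteClusterIn G ↑L ω x := (Finset.mem_filter.1 hv).2
  have heq := Literature.Probability.Percolation.siteClusterIn_eq_of_mem hv'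
  refine ⟨?_, ?_⟩
  · ext y; simp only [Finset.mem_filter, heq]
  · simpa only [heq] using hreach

omit [DecidableRel G.Adj] in
open Classical in
/-- Sites of members of `𝒞` are open sites of `L`. [cite: Cerf2015, §2–§3] -/
theorem mem_open_of_mem_reachingClusters {L Λ : Finset V} {ω : SiteConfig V} {C : Finset V}
    (hC : C ∈ reachingClusters G L Λ ω) {v : V} (hv : v ∈ C) : v ∈ ω ∧ v ∈ L := by
  obtain ⟨x, -, -, rfl⟩ := mem_reachingClusters_iff.1 hC
  obtain ⟨hvL, hv'⟩ := Finset.mem_filter.1 hv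
  exact ⟨(mem_open_of_mem_siteClusterIn hv').1, hvL⟩

omit [DecidableRel G.Adj] in
open Classical in
/-- The finite restricted cluster of a site of `Λ` whose cluster reaches `∂ⁱⁿ L` belongs to
`𝒞`. [cite: Cerf2015, §2–§3] -/
theorem filter_mem_reachingClusters {L Λ : Finset V} {ω : SiteConfig V} {v : V} (hv : v ∈ Λ)
    (hreach : ∃ w ∈ innerBoundary G L, w ∈ siteClusterIn G ↑L ω v) :
    L.filter (fun y => y ∈ siteClusterIn G ↑L ω v) ∈ reachingClusters G L Λ ω :=
  mem_reachingClusters_iff.2 ⟨v, hv, hreach, rfl⟩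

open Classical in
/-- **At most `max(1, deg x)` members of `𝒞` have `x` in their closure** (Cerf 2015, p. 9: "A
site `x` belongs to at most `2d` sets of the collection `{C̄ : C ∈ 𝒞}`"): if `x` is open they
all contain `x`, hence coincide; if `x` is closed each is the cluster of a neighbour of `x`.
[cite: Cerf2015, §5 (p. 9)] -/
theorem card_filter_closure_le {L Λ : Finset V} {ω : SiteConfig V} {x : V} (hxL : x ∈ L) :
    ((reachingClusters G L Λ ω).filter (fun C => x ∈ C ∨ ∃ z ∈ C, G.Adj z x)).card ≤
      max 1 (G.neighborFinset x).card := by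
  by_cases hxω : x ∈ ω
  · refine le_trans (Finset.card_le_one.2 ?_) (le_max_left _ _)
    intro C hC C' hC'
    obtain ⟨hC, hCx⟩ := Finset.mem_filter.1 hC
    obtain ⟨hC', hC'x⟩ := Finset.mem_filter.1 hC'
    have hxmem : ∀ {D : Finset V}, D ∈ reachingClusters G L Λ ω →
        (x ∈ D ∨ ∃ z ∈ D, G.Adj z x) → x ∈ D := by
      intro D hD hDx
      rcases hDx with h | ⟨z, hz, hzx⟩
      · exact h
      · obtain ⟨hDeq, -⟩ := eq_filter_of_mem_reachingClusters hD hz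
        rw [hDeq] at hz ⊢
        rw [Finset.mem_filter] at hz ⊢
        exact ⟨hxL, mem_siteClusterIn_of_adj hz.2 hzx hxω (Finset.mem_coe.2 hxL)⟩
    have h1 := (eq_filter_of_mem_reachingClusters hC (hxmem hC hCx)).1
    have h2 := (eq_filter_of_mem_reachingClusters hC' (hxmem hC' hC'x)).1
    rw [h1, h2]
  · refine le_trans ?_ (le_max_right _ _)
    have hsub : (reachingClusters G L Λ ω).filter (fun C => x ∈ C ∨ ∃ z ∈ C, G.Adj z x) ⊆
        (G.neighborFinset x).image
          fun z => L.filter (fun y => y ∈ siteClusterIn G ↑L ω z) := by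
      intro C hC
      obtain ⟨hC, hCx⟩ := Finset.mem_filter.1 hC
      rcases hCx with h | ⟨z, hz, hzx⟩
      · exact absurd (mem_open_of_mem_reachingClusters hC h).1 hxω
      · exact Finset.mem_image.2 ⟨z, (G.mem_neighborFinset x z).2 hzx.symm,
          (eq_filter_of_mem_reachingClusters hC hz).1.symm⟩
    exact (Finset.card_le_card hsub).trans Finset.card_image_le

omit [DecidableRel G.Adj] in
open Classical in
/-- **The members of `𝒞` containing `x ∈ Λ`**: exactly one (`C_L(x)`) if `x` is open and its
cluster reaches `∂ⁱⁿ L` (i.e. `x ∈ F`), none otherwise. [cite: Cerf2015, §3 (p. 6)] -/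
theorem card_filter_mem_reachingClusters {L Λ : Finset V} (hΛL : Λ ⊆ L) {ω : SiteConfig V}
    {x : V} (hx : x ∈ Λ) :
    (((reachingClusters G L Λ ω).filter (fun C => x ∈ C)).card : ℝ) =
      if x ∈ ω ∧ ∃ w ∈ innerBoundary G L, w ∈ siteClusterIn G ↑L ω x then 1 else 0 := by
  split_ifs with h
  · rw [Nat.cast_eq_one, Finset.card_eq_one]
    refine ⟨L.filter (fun y => y ∈ siteClusterIn G ↑L ω x), ?_⟩
    ext C
    simp only [Finset.mem_filter, Finset.mem_singleton]
    constructor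
    · rintro ⟨hC, hxC⟩
      exact (eq_filter_of_mem_reachingClusters hC hxC).1
    · rintro rfl
      refine ⟨filter_mem_reachingClusters hx h.2, ?_⟩
      rw [Finset.mem_filter]
      exact ⟨hΛL hx, (mem_siteClusterIn_self_iff G ↑L ω x).2 ⟨h.1, Finset.mem_coe.2 (hΛL hx)⟩⟩
  · rw [Nat.cast_eq_zero, Finset.card_eq_zero, Finset.filter_eq_empty_iff]
    intro C hC hxC
    apply h
    obtain ⟨-, hreach⟩ := eq_filter_of_mem_reachingClusters hC hxC
    exact ⟨(mem_open_of_mem_reachingClusters hC hxC).1, hreach⟩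

open Classical in
/-- The open sites of `C̄ ∩ Λ'` are the sites of `C ∩ Λ'`, for `C ∈ 𝒞` and `Λ' ⊆ L`.
[cite: Cerf2015, §3 (p. 6)] -/
theorem filter_closure_open_eq {L Λ Λ' : Finset V} (hΛ'L : Λ' ⊆ L) {ω : SiteConfig V}
    {C : Finset V} (hC : C ∈ reachingClusters G L Λ ω) :
    (Λ'.filter fun y => (y ∈ C ∨ ∃ z ∈ C, G.Adj z y) ∧ y ∈ ω) = Λ'.filter fun y => y ∈ C := by
  ext y
  simp only [Finset.mem_filter]
  constructor
  · rintro ⟨hy, hyC | ⟨z, hz, hzy⟩, hyω⟩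
    · exact ⟨hy, hyC⟩
    · refine ⟨hy, ?_⟩
      obtain ⟨hCeq, -⟩ := eq_filter_of_mem_reachingClusters hC hz
      rw [hCeq] at hz ⊢
      rw [Finset.mem_filter] at hz ⊢
      exact ⟨hΛ'L hy, mem_siteClusterIn_of_adj hz.2 hzy hyω (Finset.mem_coe.2 (hΛ'L hy))⟩
  · rintro ⟨hy, hyC⟩
    exact ⟨hy, Or.inl hyC, (mem_open_of_mem_reachingClusters hC hyC).1⟩

open Classical in
/-- **`h(C̄ ∩ Λ')` in terms of the closed and open counts**, for `C ∈ 𝒞`: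
`h = #{closed sites of C̄ ∩ Λ'}/(1−p) − |C ∩ Λ'|/p`. [cite: Cerf2015, §3 (p. 6)] -/
theorem cerfH_closure_eq {L Λ Λ' : Finset V} (hΛ'L : Λ' ⊆ L) {ω : SiteConfig V} {C : Finset V}
    (hC : C ∈ reachingClusters G L Λ ω) (p : ℝ) :
    cerfH p ω (Λ'.filter fun y => y ∈ C ∨ ∃ z ∈ C, G.Adj z y) =
      1 / (1 - p) * ((Λ'.filter fun y => (y ∈ C ∨ ∃ z ∈ C, G.Adj z y) ∧ y ∉ ω).card : ℝ) -
        1 / p * ((Λ'.filter fun y => y ∈ C).card : ℝ) := by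
  unfold cerfH
  rw [Finset.filter_filter, Finset.filter_filter, filter_closure_open_eq hΛ'L hC]

open Classical in
/-- `|C̄ ∩ Λ'| = #{closed sites of C̄ ∩ Λ'} + |C ∩ Λ'|` for `C ∈ 𝒞`. [cite: Cerf2015, §3 (p. 6)] -/
theorem card_closure_eq {L Λ Λ' : Finset V} (hΛ'L : Λ' ⊆ L) {ω : SiteConfig V} {C : Finset V}
    (hC : C ∈ reachingClusters G L Λ ω) :
    (Λ'.filter fun y => y ∈ C ∨ ∃ z ∈ C, G.Adj z y).card =
      (Λ'.filter fun y => (y ∈ C ∨ ∃ z ∈ C, G.Adj z y) ∧ y ∉ ω).card +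
        (Λ'.filter fun y => y ∈ C).card := by
  rw [← filter_closure_open_eq hΛ'L hC (Λ' := Λ'), ← Finset.filter_filter, ← Finset.filter_filter,
    add_comm]
  exact (Finset.card_filter_add_card_filter_not (s := Λ'.filter fun y => y ∈ C ∨ ∃ z ∈ C, G.Adj z y)
    (fun y => y ∈ ω)).symm

omit [G.LocallyFinite] in
open Classical in
/-- The closure trace of the finite cluster of `x'` is `clusterClosureIn`.
[cite: Cerf2015, §3–§4] -/
theorem filter_closure_filter_eq_clusterClosureIn {L Λ' : Finset V} (ω : SiteConfig V) (x' : V) :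
    (Λ'.filter fun y => y ∈ L.filter (fun t => t ∈ siteClusterIn G ↑L ω x') ∨
      ∃ z ∈ L.filter (fun t => t ∈ siteClusterIn G ↑L ω x'), G.Adj z y) =
      clusterClosureIn G L Λ' ω x' := by
  ext y
  simp only [Finset.mem_filter, mem_clusterClosureIn_iff]
  have hL : ∀ t, t ∈ siteClusterIn G ↑L ω x' → t ∈ L := fun t ht =>
    Finset.mem_coe.1 (mem_open_of_mem_siteClusterIn ht).2
  constructor
  · rintro ⟨hy, ⟨-, h⟩ | ⟨z, ⟨-, hz⟩, hzy⟩⟩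
    · exact ⟨hy, Or.inl h⟩
    · exact ⟨hy, Or.inr ⟨z, hz, hzy⟩⟩
  · rintro ⟨hy, h | ⟨z, hz, hzy⟩⟩
    · exact ⟨hy, Or.inl ⟨hL y h, h⟩⟩
    · exact ⟨hy, Or.inr ⟨z, ⟨hL z hz, hz⟩, hzy⟩⟩

end ClusterFamily

/-! ### The pointwise inequalities of §3 and §5 -/

section Pointwise

variable {G : SimpleGraph V} [DecidableEq V] [G.LocallyFinite] [DecidableRel G.Adj]

open Classical in
/-- **The counting inequality of §3** (Cerf 2015, p. 6: `E|F| = p E|F ∪ G|`,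
`E|G| = (1−p) E|F ∪ G|`, `|H| ≤ Σ_{C ∈ 𝒞} |∂ᵒᵘᵗC ∩ Λ(n)| − |G|`,
`E|H| ≤ (1−p) E(Σ_{C ∈ 𝒞} h(C̄ ∩ Λ(n)))`), in its pointwise form before taking expectations:
with `m_x = #{C ∈ 𝒞 : x ∈ C̄}`,
`Σ_x 𝟙[x closed, m_x ≥ 2] + Σ_x 𝟙[x closed, m_x ≥ 1] − ((1−p)/p) Σ_x #{C ∈ 𝒞 : x ∈ C}
≤ (1−p) Σ_{C ∈ 𝒞} h(C̄ ∩ Λ')` (in fact an identity up to the first inequality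
`𝟙_H + 𝟙_G ≤ 𝟙[closed] m`). [cite: Cerf2015, §3 (p. 6)] -/
theorem counting_le {L Λ Λ' : Finset V} (hΛ'L : Λ' ⊆ L) (ω : SiteConfig V) {p : ℝ} (hp0 : p ≠ 0)
    (hp1 : 1 - p ≠ 0) :
    ∑ x ∈ Λ', (if x ∉ ω ∧ 2 ≤ ((reachingClusters G L Λ ω).filter
        (fun C => x ∈ C ∨ ∃ z ∈ C, G.Adj z x)).card then (1 : ℝ) else 0) +
      ∑ x ∈ Λ', (if x ∉ ω ∧ 1 ≤ ((reachingClusters G L Λ ω).filter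
        (fun C => x ∈ C ∨ ∃ z ∈ C, G.Adj z x)).card then (1 : ℝ) else 0) -
      (1 - p) / p * ∑ x ∈ Λ', (((reachingClusters G L Λ ω).filter (fun C => x ∈ C)).card : ℝ) ≤
    (1 - p) * ∑ C ∈ reachingClusters G L Λ ω,
      cerfH p ω (Λ'.filter fun y => y ∈ C ∨ ∃ z ∈ C, G.Adj z y) := by
  set 𝒞 := reachingClusters G L Λ ω with h𝒞
  -- (i) `𝟙_H(x) + 𝟙_G(x) ≤ 𝟙[x closed] m_x`
  have h1 : ∀ x ∈ Λ',
      (if x ∉ ω ∧ 2 ≤ (𝒞.filter (fun C => x ∈ C ∨ ∃ z ∈ C, G.Adj z x)).card then (1 : ℝ) else 0) +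
        (if x ∉ ω ∧ 1 ≤ (𝒞.filter (fun C => x ∈ C ∨ ∃ z ∈ C, G.Adj z x)).card then (1 : ℝ)
          else 0) ≤
      ∑ C ∈ 𝒞, (if (x ∈ C ∨ ∃ z ∈ C, G.Adj z x) ∧ x ∉ ω then (1 : ℝ) else 0) := by
    intro x _
    by_cases hxω : x ∈ ω
    · simp [hxω]
    · have hm : ∑ C ∈ 𝒞, (if (x ∈ C ∨ ∃ z ∈ C, G.Adj z x) ∧ x ∉ ω then (1 : ℝ) else 0) =
          ((𝒞.filter (fun C => x ∈ C ∨ ∃ z ∈ C, G.Adj z x)).card : ℝ) := by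
        rw [Finset.natCast_card_filter]
        refine Finset.sum_congr rfl fun C _ => ?_
        simp [hxω]
      rw [hm]
      set m := (𝒞.filter (fun C => x ∈ C ∨ ∃ z ∈ C, G.Adj z x)).card with hmdef
      rcases Nat.lt_or_ge m 2 with hm2 | hm2
      · rw [if_neg (fun h => absurd h.2 (not_le.2 hm2))]
        rcases Nat.lt_or_ge m 1 with hm1 | hm1
        · rw [if_neg (fun h => absurd h.2 (not_le.2 hm1))]
          simp
        · rw [if_pos ⟨hxω, hm1⟩]
          have : (1 : ℝ) ≤ m := by exact_mod_cast hm1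
          linarith
      · rw [if_pos ⟨hxω, hm2⟩, if_pos ⟨hxω, le_trans one_le_two hm2⟩]
        have : (2 : ℝ) ≤ m := by exact_mod_cast hm2
        linarith
  -- (ii) double counting of the closed sites of the closures
  have h2 : ∑ x ∈ Λ', ∑ C ∈ 𝒞, (if (x ∈ C ∨ ∃ z ∈ C, G.Adj z x) ∧ x ∉ ω then (1 : ℝ) else 0) =
      ∑ C ∈ 𝒞, ((Λ'.filter fun y => (y ∈ C ∨ ∃ z ∈ C, G.Adj z y) ∧ y ∉ ω).card : ℝ) := by
    rw [Finset.sum_comm]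
    refine Finset.sum_congr rfl fun C _ => ?_
    rw [Finset.natCast_card_filter]
  -- (iii) double counting of the open sites
  have h3 : ∑ x ∈ Λ', ((𝒞.filter (fun C => x ∈ C)).card : ℝ) =
      ∑ C ∈ 𝒞, ((Λ'.filter fun y => y ∈ C).card : ℝ) := by
    simp_rw [Finset.natCast_card_filter]
    rw [Finset.sum_comm]
  -- (iv) `cc − ((1−p)/p) oc = (1−p) h`
  have h4 : ∀ C ∈ 𝒞, ((Λ'.filter fun y => (y ∈ C ∨ ∃ z ∈ C, G.Adj z y) ∧ y ∉ ω).card : ℝ) -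
      (1 - p) / p * ((Λ'.filter fun y => y ∈ C).card : ℝ) =
      (1 - p) * cerfH p ω (Λ'.filter fun y => y ∈ C ∨ ∃ z ∈ C, G.Adj z y) := by
    intro C hC
    rw [cerfH_closure_eq hΛ'L hC]
    field_simp
  calc _ ≤ ∑ x ∈ Λ', ∑ C ∈ 𝒞, (if (x ∈ C ∨ ∃ z ∈ C, G.Adj z x) ∧ x ∉ ω then (1 : ℝ) else 0) -
        (1 - p) / p * ∑ x ∈ Λ', ((𝒞.filter (fun C => x ∈ C)).card : ℝ) := by
          rw [← Finset.sum_add_distrib]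
          exact sub_le_sub_right (Finset.sum_le_sum h1) _
    _ = ∑ C ∈ 𝒞, (((Λ'.filter fun y => (y ∈ C ∨ ∃ z ∈ C, G.Adj z y) ∧ y ∉ ω).card : ℝ) -
        (1 - p) / p * ((Λ'.filter fun y => y ∈ C).card : ℝ)) := by
          rw [h2, h3, Finset.sum_sub_distrib, Finset.mul_sum]
    _ = ∑ C ∈ 𝒞, (1 - p) * cerfH p ω (Λ'.filter fun y => y ∈ C ∨ ∃ z ∈ C, G.Adj z y) :=
          Finset.sum_congr rfl h4
    _ = _ := by rw [Finset.mul_sum]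

open Classical in
/-- **The bounds of §5** (Cerf 2015, p. 9), pointwise: with `K_C = |C̄ ∩ Λ'|`,
`h_C = h(C̄ ∩ Λ')`, `m_x ≤ M` for all `x ∈ Λ'` (so `Σ_C K_C = Σ_x m_x ≤ M |Λ'|`), a threshold
`a ≥ 0` (Cerf: `a = ln n`) and the event `ℰ = {∀ C ∈ 𝒞, K_C = 0 ∨ |h_C| < a √K_C}`:
"on `ℰ`, `Σ_C |h_C| ≤ a √|𝒞| (Σ_C K_C)^{1/2}`" (Cauchy–Schwarz) and "if `ℰ` does not occur,
`|h_C| ≤ K_C/(p(1−p))` and `Σ_C |h_C| ≤ M|Λ'|/(p(1−p))`"; together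
`Σ_C |h_C| ≤ a √(M|Λ'|) √|𝒞| + (M|Λ'|/(p(1−p))) 𝟙_{ℰᶜ}`. [cite: Cerf2015, §5 (p. 9)] -/
theorem sum_abs_cerfH_le {L Λ Λ' : Finset V} (hΛ'L : Λ' ⊆ L) (ω : SiteConfig V) {p : ℝ}
    (hp0 : 0 < p) (hp1 : p < 1) {a : ℝ} (ha : 0 ≤ a) {M : ℕ}
    (hM : ∀ x ∈ Λ', ((reachingClusters G L Λ ω).filter
      (fun C => x ∈ C ∨ ∃ z ∈ C, G.Adj z x)).card ≤ M) :
    ∑ C ∈ reachingClusters G L Λ ω, |cerfH p ω (Λ'.filter fun y => y ∈ C ∨ ∃ z ∈ C, G.Adj z y)| ≤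
      a * Real.sqrt (M * Λ'.card) * Real.sqrt (reachingClusters G L Λ ω).card +
        M * Λ'.card / (p * (1 - p)) *
          (if ∃ C ∈ reachingClusters G L Λ ω,
              (Λ'.filter fun y => y ∈ C ∨ ∃ z ∈ C, G.Adj z y).card ≠ 0 ∧
                a * Real.sqrt ((Λ'.filter fun y => y ∈ C ∨ ∃ z ∈ C, G.Adj z y).card) ≤
                  |cerfH p ω (Λ'.filter fun y => y ∈ C ∨ ∃ z ∈ C, G.Adj z y)|
            then 1 else 0) := by
  set 𝒞 := reachingClusters G L Λ ω with h𝒞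
  have hp1' : 0 < 1 - p := by linarith
  have hpq : 0 < p * (1 - p) := mul_pos hp0 hp1'
  -- `Σ_C K_C ≤ M |Λ'|`
  have hK : ∑ C ∈ 𝒞, ((Λ'.filter fun y => y ∈ C ∨ ∃ z ∈ C, G.Adj z y).card : ℝ) ≤ M * Λ'.card := by
    calc ∑ C ∈ 𝒞, ((Λ'.filter fun y => y ∈ C ∨ ∃ z ∈ C, G.Adj z y).card : ℝ)
        = ∑ C ∈ 𝒞, ∑ x ∈ Λ', (if x ∈ C ∨ ∃ z ∈ C, G.Adj z x then (1 : ℝ) else 0) := by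
          refine Finset.sum_congr rfl fun C _ => ?_
          rw [Finset.natCast_card_filter]
      _ = ∑ x ∈ Λ', ((𝒞.filter (fun C => x ∈ C ∨ ∃ z ∈ C, G.Adj z x)).card : ℝ) := by
          rw [Finset.sum_comm]
          refine Finset.sum_congr rfl fun x _ => ?_
          rw [Finset.natCast_card_filter]
      _ ≤ ∑ x ∈ Λ', (M : ℝ) := Finset.sum_le_sum fun x hx => by exact_mod_cast hM x hx
      _ = M * Λ'.card := by rw [Finset.sum_const, nsmul_eq_mul, mul_comm]
  -- `|h_C| ≤ K_C/(p(1−p))`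
  have habs : ∀ C ∈ 𝒞, |cerfH p ω (Λ'.filter fun y => y ∈ C ∨ ∃ z ∈ C, G.Adj z y)| ≤
      ((Λ'.filter fun y => y ∈ C ∨ ∃ z ∈ C, G.Adj z y).card : ℝ) / (p * (1 - p)) := by
    intro C hC
    rw [cerfH_closure_eq hΛ'L hC, card_closure_eq hΛ'L hC, Nat.cast_add, add_div]
    set cc : ℝ := ((Λ'.filter fun y => (y ∈ C ∨ ∃ z ∈ C, G.Adj z y) ∧ y ∉ ω).card : ℝ) with hcc
    set oc : ℝ := ((Λ'.filter fun y => y ∈ C).card : ℝ) with hoc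
    have hcc0 : 0 ≤ cc := Nat.cast_nonneg _
    have hoc0 : 0 ≤ oc := Nat.cast_nonneg _
    have e1 : 1 / (1 - p) * cc ≤ cc / (p * (1 - p)) := by
      rw [one_div_mul_eq_div]
      exact div_le_div_of_nonneg_left hcc0 hpq (by nlinarith)
    have e2 : 1 / p * oc ≤ oc / (p * (1 - p)) := by
      rw [one_div_mul_eq_div]
      exact div_le_div_of_nonneg_left hoc0 hpq (by nlinarith)
    calc |1 / (1 - p) * cc - 1 / p * oc| ≤ |1 / (1 - p) * cc| + |1 / p * oc| := abs_sub _ _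
      _ = 1 / (1 - p) * cc + 1 / p * oc := by
          rw [abs_of_nonneg (by positivity), abs_of_nonneg (by positivity)]
      _ ≤ cc / (p * (1 - p)) + oc / (p * (1 - p)) := add_le_add e1 e2
  have hfirst0 : 0 ≤ a * Real.sqrt (M * Λ'.card) * Real.sqrt 𝒞.card := by positivity
  have hsecond0 : 0 ≤ (M : ℝ) * Λ'.card / (p * (1 - p)) := by positivity
  split_ifs with hbad
  · -- off `ℰ`
    rw [mul_one]
    calc ∑ C ∈ 𝒞, |cerfH p ω (Λ'.filter fun y => y ∈ C ∨ ∃ z ∈ C, G.Adj z y)|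
        ≤ ∑ C ∈ 𝒞, ((Λ'.filter fun y => y ∈ C ∨ ∃ z ∈ C, G.Adj z y).card : ℝ) / (p * (1 - p)) :=
          Finset.sum_le_sum habs
      _ = (∑ C ∈ 𝒞, ((Λ'.filter fun y => y ∈ C ∨ ∃ z ∈ C, G.Adj z y).card : ℝ)) /
            (p * (1 - p)) := by
          rw [Finset.sum_div]
      _ ≤ M * Λ'.card / (p * (1 - p)) := div_le_div_of_nonneg_right hK hpq.le
      _ ≤ _ := le_add_of_nonneg_left hfirst0
  · -- on `ℰ`
    rw [mul_zero, add_zero]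
    push Not at hbad
    have hle : ∀ C ∈ 𝒞, |cerfH p ω (Λ'.filter fun y => y ∈ C ∨ ∃ z ∈ C, G.Adj z y)| ≤
        a * Real.sqrt ((Λ'.filter fun y => y ∈ C ∨ ∃ z ∈ C, G.Adj z y).card) := by
      intro C hC
      by_cases hK0 : (Λ'.filter fun y => y ∈ C ∨ ∃ z ∈ C, G.Adj z y).card = 0
      · rw [Finset.card_eq_zero] at hK0
        have h0 : cerfH p ω (Λ'.filter fun y => y ∈ C ∨ ∃ z ∈ C, G.Adj z y) = 0 := by
          rw [hK0]; exact cerfH_empty p ω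
        rw [h0, abs_zero]
        exact mul_nonneg ha (Real.sqrt_nonneg _)
      · exact (hbad C hC hK0).le
    have hCS : ∑ C ∈ 𝒞, Real.sqrt ((Λ'.filter fun y => y ∈ C ∨ ∃ z ∈ C, G.Adj z y).card) ≤
        Real.sqrt (𝒞.card *
          ∑ C ∈ 𝒞, ((Λ'.filter fun y => y ∈ C ∨ ∃ z ∈ C, G.Adj z y).card : ℝ)) := by
      refine (Real.le_sqrt (Finset.sum_nonneg fun C _ => Real.sqrt_nonneg _)
        (mul_nonneg (Nat.cast_nonneg _) (Finset.sum_nonneg fun C _ => Nat.cast_nonneg _))).2 ?_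
      have := sq_sum_le_card_mul_sum_sq (s := 𝒞)
        (f := fun C => Real.sqrt ((Λ'.filter fun y => y ∈ C ∨ ∃ z ∈ C, G.Adj z y).card))
      refine this.trans (le_of_eq ?_)
      congr 1
      refine Finset.sum_congr rfl fun C _ => ?_
      rw [Real.sq_sqrt (Nat.cast_nonneg _)]
    calc ∑ C ∈ 𝒞, |cerfH p ω (Λ'.filter fun y => y ∈ C ∨ ∃ z ∈ C, G.Adj z y)|
        ≤ ∑ C ∈ 𝒞, a * Real.sqrt ((Λ'.filter fun y => y ∈ C ∨ ∃ z ∈ C, G.Adj z y).card) :=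
          Finset.sum_le_sum hle
      _ = a * ∑ C ∈ 𝒞, Real.sqrt ((Λ'.filter fun y => y ∈ C ∨ ∃ z ∈ C, G.Adj z y).card) := by
          rw [Finset.mul_sum]
      _ ≤ a * Real.sqrt (𝒞.card * ∑ C ∈ 𝒞,
            ((Λ'.filter fun y => y ∈ C ∨ ∃ z ∈ C, G.Adj z y).card : ℝ)) :=
          mul_le_mul_of_nonneg_left hCS ha
      _ ≤ a * Real.sqrt (𝒞.card * (M * Λ'.card)) :=
          mul_le_mul_of_nonneg_left (Real.sqrt_le_sqrt
            (mul_le_mul_of_nonneg_left hK (Nat.cast_nonneg _))) ha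
      _ = a * Real.sqrt (M * Λ'.card) * Real.sqrt 𝒞.card := by
          rw [Real.sqrt_mul (Nat.cast_nonneg _)]; ring

end Pointwise

/-! ### The events `F`, `G` and their common factor `N_x` -/

section Events

/-- **Last visit decomposition** of a reflexive–transitive chain: a chain from `a` to `b ≠ a`
passes, after its last visit to `a`, to some `c` with `r a c` and then avoids `a`. [folklore] -/
theorem reflTransGen_avoid {α : Type*} {r : α → α → Prop} {a b : α}
    (h : Relation.ReflTransGen r a b) :
    b = a ∨ ∃ c, r a c ∧ Relation.ReflTransGen (fun u v => r u v ∧ u ≠ a ∧ v ≠ a) c b := by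
  classical
  induction h with
  | refl => exact Or.inl rfl
  | @tail b' c hab hbc ih =>
    by_cases hca : c = a
    · exact Or.inl hca
    · right
      by_cases hb'a : b' = a
      · subst hb'a
        exact ⟨c, hbc, Relation.ReflTransGen.refl⟩
      · rcases ih with h | ⟨c₀, hc₀, hrt⟩
        · exact absurd h hb'a
        · exact ⟨c₀, hc₀, hrt.tail ⟨hbc, hb'a, hca⟩⟩

variable {G : SimpleGraph V} [DecidableEq V]

/-- An open path from `x` to `w ≠ x` inside `L` yields a neighbour `y` of `x` joined to `w`
inside `L ∖ {x}` (Cerf 2015, p. 6: "the event {a neighbour of `x` is connected to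
`∂ⁱⁿΛ(n+ℓ)` by an open path} is independent of the status of the site `x` itself").
[cite: Cerf2015, §3 (p. 6)] -/
theorem exists_adj_siteConnIn_erase {L : Finset V} {x w : V} {ω : SiteConfig V}
    (h : ω ∈ siteConnIn G ↑L x w) (hwx : w ≠ x) :
    ∃ y, G.Adj x y ∧ ω ∈ siteConnIn G ↑(L.erase x) y w := by
  obtain ⟨hxω, hxL, hrt⟩ := (siteConnIn_iff_reflTransGen (↑L) x w ω).1 h
  rcases reflTransGen_avoid hrt with h' | ⟨y, ⟨hxy, -, -, hyω, hyL⟩, hrt'⟩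
  · exact absurd h' hwx
  · refine ⟨y, hxy, (siteConnIn_iff_reflTransGen (↑(L.erase x)) y w ω).2 ⟨hyω, ?_, ?_⟩⟩
    · rw [Finset.coe_erase]
      exact ⟨hyL, fun h' => G.ne_of_adj hxy (Set.mem_singleton_iff.1 h').symm⟩
    · refine Relation.ReflTransGen.mono (fun u v huv => ?_) y w hrt'
      obtain ⟨⟨hadj, huω, huL, hvω, hvL⟩, hua, hva⟩ := huv
      rw [Finset.coe_erase]
      exact ⟨hadj, huω, ⟨huL, fun h' => hua (Set.mem_singleton_iff.1 h')⟩, hvω,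
        ⟨hvL, fun h' => hva (Set.mem_singleton_iff.1 h')⟩⟩

variable [G.LocallyFinite]

/-- The event `N_x`, "a neighbour of `x` is joined to `∂ⁱⁿ L` inside `L ∖ {x}`", is determined
by the sites of `L ∖ {x}`. [cite: Cerf2015, §3 (p. 6)] -/
theorem determinedBy_adj_siteConnIn_erase (L : Finset V) (x : V) :
    DeterminedBy {ω : SiteConfig V | ∃ y, G.Adj x y ∧ ∃ w ∈ innerBoundary G L,
      ω ∈ siteConnIn G ↑(L.erase x) y w} ↑(L.erase x) := by
  have hset : {ω : SiteConfig V | ∃ y, G.Adj x y ∧ ∃ w ∈ innerBoundary G L,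
      ω ∈ siteConnIn G ↑(L.erase x) y w} =
      ⋃ y, ⋃ (_ : G.Adj x y), ⋃ w ∈ innerBoundary G L, siteConnIn G ↑(L.erase x) y w := by
    ext ω
    simp only [Set.mem_setOf_eq, Set.mem_iUnion, exists_prop]
  rw [hset]
  exact DeterminedBy.iUnion fun y => DeterminedBy.iUnion fun _ =>
    DeterminedBy.iUnion fun w => DeterminedBy.iUnion fun _ => determinedBy_siteConnIn G _ y w

open Classical in
/-- **The event `{x ∈ G}`** (Cerf 2015, p. 6: "A site of `Λ(n)` belongs to `G` if it is closed
and it has a neighbour which is connected to `∂ⁱⁿΛ(n+ℓ)` by an open path"): for a site `x`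
all of whose neighbours lie in `Λ`, `x` is closed and lies in the closure of a member of `𝒞`
iff `x` is closed and `N_x` occurs. [cite: Cerf2015, §3 (p. 6)] -/
theorem closed_mem_closure_iff {L Λ : Finset V} {x : V} (hxΛ : ∀ y, G.Adj x y → y ∈ Λ)
    (ω : SiteConfig V) :
    (x ∉ ω ∧ ∃ C ∈ reachingClusters G L Λ ω, x ∈ C ∨ ∃ z ∈ C, G.Adj z x) ↔
      x ∉ ω ∧ ∃ y, G.Adj x y ∧ ∃ w ∈ innerBoundary G L, ω ∈ siteConnIn G ↑(L.erase x) y w := by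
  constructor
  · rintro ⟨hxω, C, hC, hx | ⟨z, hz, hzx⟩⟩
    · exact absurd (mem_open_of_mem_reachingClusters hC hx).1 hxω
    · refine ⟨hxω, z, hzx.symm, ?_⟩
      obtain ⟨-, w, hw, hwz⟩ := eq_filter_of_mem_reachingClusters hC hz
      refine ⟨w, hw, ?_⟩
      have h1 : ω ∈ siteConnIn G (↑L ∩ {x}ᶜ) z w :=
        siteConnIn_inter_of_forall (T := {x}ᶜ) (fun t ht hteq => hxω (by
          rw [Set.mem_singleton_iff] at hteq
          rw [← hteq]; exact ht.2.1)) hwz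
      rw [Finset.coe_erase, Set.sdiff_eq]
      exact h1
  · rintro ⟨hxω, y, hxy, w, hw, hyw⟩
    refine ⟨hxω, L.filter (fun t => t ∈ siteClusterIn G ↑L ω y), ?_, Or.inr ⟨y, ?_, hxy.symm⟩⟩
    · refine filter_mem_reachingClusters (hxΛ y hxy) ⟨w, hw, ?_⟩
      exact siteConnIn_mono G (by rw [Finset.coe_erase]; exact Set.sdiff_subset) y w hyw
    · rw [Finset.mem_filter]
      have hy : y ∈ ω ∧ y ∈ (↑(L.erase x) : Set V) := by
        obtain ⟨hyω, -, hyL, -, -⟩ := hyw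
        exact ⟨hyω, hyL⟩
      refine ⟨Finset.mem_of_mem_erase (Finset.mem_coe.1 hy.2), ?_⟩
      exact (mem_siteClusterIn_self_iff G ↑L ω y).2
        ⟨hy.1, Finset.mem_coe.2 (Finset.mem_of_mem_erase (Finset.mem_coe.1 hy.2))⟩

/-- **The event `{x ∈ F}`** (Cerf 2015, p. 6: "A site of `Λ(n)` belongs to `F` if it is
connected to `∂ⁱⁿΛ(n+ℓ)` by an open path"): for a site `x ∈ L` all of whose neighbours lie in
`L`, `x` is open and its cluster reaches `∂ⁱⁿ L` iff `x` is open and `N_x` occurs.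
[cite: Cerf2015, §3 (p. 6)] -/
theorem open_reaches_iff {L : Finset V} {x : V} (hxL : x ∈ L) (hxint : ∀ y, G.Adj x y → y ∈ L)
    (ω : SiteConfig V) :
    (x ∈ ω ∧ ∃ w ∈ innerBoundary G L, w ∈ siteClusterIn G ↑L ω x) ↔
      x ∈ ω ∧ ∃ y, G.Adj x y ∧ ∃ w ∈ innerBoundary G L, ω ∈ siteConnIn G ↑(L.erase x) y w := by
  constructor
  · rintro ⟨hxω, w, hw, hxw⟩
    have hwx : w ≠ x := by
      rintro rfl
      obtain ⟨-, y, hy, hwy⟩ := mem_innerBoundary_iff.1 hw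
      exact hy (hxint y hwy)
    obtain ⟨y, hxy, hyw⟩ := exists_adj_siteConnIn_erase hxw hwx
    exact ⟨hxω, y, hxy, w, hw, hyw⟩
  · rintro ⟨hxω, y, hxy, w, hw, hyw⟩
    refine ⟨hxω, w, hw, ?_⟩
    have hyω : y ∈ ω := hyw.1
    have h1 : ω ∈ siteConnIn G ↑L x y :=
      mem_siteConnIn_of_adj G hxω hyω (Finset.mem_coe.2 hxL) (Finset.mem_coe.2 (hxint y hxy)) hxy
    have h2 : ω ∈ siteConnIn G ↑L y w :=
      siteConnIn_mono G (by rw [Finset.coe_erase]; exact Set.sdiff_subset) y w hyw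
    exact siteConnIn_trans G subset_rfl subset_rfl h1 h2

/-- `P_p({x closed} ∩ N_x) = (1 − p) P_p(N_x)`: `N_x` does not look at `x`.
[cite: Cerf2015, §3 (p. 6)] -/
theorem real_closed_inter_eq (p : unitInterval) (L : Finset V) (x : V) :
    (sitePercolation V p).real ({ω | x ∉ ω} ∩ {ω : SiteConfig V | ∃ y, G.Adj x y ∧
      ∃ w ∈ innerBoundary G L, ω ∈ siteConnIn G ↑(L.erase x) y w}) =
      (1 - p) * (sitePercolation V p).real {ω : SiteConfig V | ∃ y, G.Adj x y ∧
        ∃ w ∈ innerBoundary G L, ω ∈ siteConnIn G ↑(L.erase x) y w} := by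
  have hx : DeterminedBy {ω : SiteConfig V | x ∉ ω} (↑({x} : Finset V) : Set V) := by
    rw [Finset.coe_singleton]; exact (determinedBy_mem x).compl
  rw [sitePercolation_real_inter_of_disjoint p hx (determinedBy_adj_siteConnIn_erase L x)
    (Finset.disjoint_singleton_left.2 (Finset.notMem_erase x L))]
  congr 1
  have h := measureReal_compl (μ := sitePercolation V p) (measurableSet_siteOpen x)
  rw [probReal_univ, sitePercolation_real_mem] at h
  exact h

/-- `P_p({x open} ∩ N_x) = p P_p(N_x)`. [cite: Cerf2015, §3 (p. 6)] -/
theorem real_open_inter_eq (p : unitInterval) (L : Finset V) (x : V) :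
    (sitePercolation V p).real ({ω | x ∈ ω} ∩ {ω : SiteConfig V | ∃ y, G.Adj x y ∧
      ∃ w ∈ innerBoundary G L, ω ∈ siteConnIn G ↑(L.erase x) y w}) =
      p * (sitePercolation V p).real {ω : SiteConfig V | ∃ y, G.Adj x y ∧
        ∃ w ∈ innerBoundary G L, ω ∈ siteConnIn G ↑(L.erase x) y w} := by
  have hx : DeterminedBy {ω : SiteConfig V | x ∈ ω} (↑({x} : Finset V) : Set V) := by
    rw [Finset.coe_singleton]; exact determinedBy_mem x
  rw [sitePercolation_real_inter_of_disjoint p hx (determinedBy_adj_siteConnIn_erase L x)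
    (Finset.disjoint_singleton_left.2 (Finset.notMem_erase x L)), sitePercolation_real_mem]

end Events

/-! ### Measurability of local functionals -/

section Measurability

/-- A real functional of the configuration which only depends on the sites of a finite set
`L` is measurable (it is a finite combination of indicators of cylinder events). [folklore] -/
theorem measurable_of_forall_inter_eq {f : SiteConfig V → ℝ} (L : Finset V)
    (hf : ∀ ω, f ω = f (ω ∩ ↑L)) : Measurable f := by
  classical
  have hdet : ∀ S : Finset V,
      DeterminedBy {ω' : SiteConfig V | ∀ v ∈ L, v ∈ ω' ↔ v ∈ S} (↑L : Set V) := by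
    intro S
    rw [determinedBy_iff]
    intro ω ω' h
    have key : ∀ v ∈ L, (v ∈ ω ↔ v ∈ ω') := fun v hv => by
      have := Set.ext_iff.1 h v
      simp only [Set.mem_inter_iff, Finset.mem_coe] at this
      exact ⟨fun h1 => (this.1 ⟨h1, hv⟩).1, fun h1 => (this.2 ⟨h1, hv⟩).1⟩
    simp only [Set.mem_setOf_eq]
    exact forall₂_congr fun v hv => by rw [key v hv]
  have key : f = fun ω => ∑ S ∈ L.powerset,
      ({ω' : SiteConfig V | ∀ v ∈ L, v ∈ ω' ↔ v ∈ S}).indicator (fun _ => f ↑S) ω := by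
    funext ω
    rw [Finset.sum_eq_single (L.filter fun v => v ∈ ω)]
    · rw [Set.indicator_of_mem]
      · rw [hf ω]
        congr 1
        ext v
        simp [and_comm]
      · intro v hv
        simp [Finset.mem_filter, hv]
    · intro S hS hne
      rw [Set.indicator_of_notMem]
      intro hmem
      apply hne
      ext v
      simp only [Finset.mem_filter]
      constructor
      · intro hv
        have hvL : v ∈ L := Finset.mem_powerset.1 hS hv
        exact ⟨hvL, (hmem v hvL).2 hv⟩
      · rintro ⟨hvL, hvω⟩
        exact (hmem v hvL).1 hvω
    · intro h
      exact absurd (Finset.mem_powerset.2 (Finset.filter_subset _ _)) h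
  rw [key]
  refine Finset.measurable_sum _ fun S _ => Measurable.indicator measurable_const ?_
  exact (hdet S).measurableSet_of_finset

/-- A bounded local functional is integrable under `P_p`. [folklore] -/
theorem integrable_of_forall_inter_eq (p : unitInterval) {f : SiteConfig V → ℝ} (L : Finset V)
    (hf : ∀ ω, f ω = f (ω ∩ ↑L)) {C : ℝ} (hC : ∀ ω, |f ω| ≤ C) :
    Integrable f (sitePercolation V p) :=
  Integrable.of_bound (measurable_of_forall_inter_eq L hf).aestronglyMeasurable C
    (ae_of_all _ fun ω => by rw [Real.norm_eq_abs]; exact hC ω)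

/-- A local property of the configuration defines a measurable event. [folklore] -/
theorem measurableSet_of_forall_inter_iff {P : SiteConfig V → Prop} (L : Finset V)
    (hP : ∀ ω, P (ω ∩ ↑L) ↔ P ω) : MeasurableSet {ω | P ω} := by
  have h : DeterminedBy {ω : SiteConfig V | P ω} ↑L := by
    rw [determinedBy_iff]
    intro ω ω' hω
    simp only [Set.mem_setOf_eq]
    rw [← hP ω, hω, hP ω']
  exact h.measurableSet_of_finset

/-- `∫ 𝟙[P] dP_p = P_p(P)` for a local property. [folklore] -/
theorem integral_ite_eq_real (p : unitInterval) {P : SiteConfig V → Prop} [DecidablePred P]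
    (L : Finset V) (hP : ∀ ω, P (ω ∩ ↑L) ↔ P ω) :
    ∫ ω, (if P ω then (1 : ℝ) else 0) ∂(sitePercolation V p) =
      (sitePercolation V p).real {ω | P ω} := by
  have h : (fun ω => if P ω then (1 : ℝ) else 0) = {ω | P ω}.indicator 1 := by
    funext ω
    by_cases hω : P ω
    · rw [if_pos hω, Set.indicator_of_mem (by exact hω)]; rfl
    · rw [if_neg hω, Set.indicator_of_notMem (by exact hω)]
  rw [h, integral_indicator_one (measurableSet_of_forall_inter_iff L hP)]

/-- The indicator of a local property is integrable. [folklore] -/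
theorem integrable_ite (p : unitInterval) {P : SiteConfig V → Prop} [DecidablePred P]
    (L : Finset V) (hP : ∀ ω, P (ω ∩ ↑L) ↔ P ω) :
    Integrable (fun ω => if P ω then (1 : ℝ) else 0) (sitePercolation V p) := by
  refine integrable_of_forall_inter_eq p L (fun ω => ?_) (C := 1) (fun ω => ?_)
  · by_cases hω : P ω
    · rw [if_pos hω, if_pos ((hP ω).2 hω)]
    · rw [if_neg hω, if_neg (fun h => hω ((hP ω).1 h))]
  · by_cases hω : P ω
    · rw [if_pos hω]; simp
    · rw [if_neg hω]; simp

variable {G : SimpleGraph V}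

/-- Restricted clusters are local. [folklore] -/
theorem siteClusterIn_inter_self (L : Finset V) (ω : SiteConfig V) (x : V) :
    siteClusterIn G ↑L (ω ∩ ↑L) x = siteClusterIn G ↑L ω x :=
  siteClusterIn_eq_of_inter_eq G (by rw [Set.inter_assoc, Set.inter_self]) x

open Classical in
/-- The collection `𝒞` is local. [folklore] -/
theorem reachingClusters_inter_self [DecidableEq V] [G.LocallyFinite] (L Λ : Finset V)
    (ω : SiteConfig V) :
    reachingClusters G L Λ (ω ∩ ↑L) = reachingClusters G L Λ ω := by
  simp only [reachingClusters, siteClusterIn_inter_self]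

open Classical in
/-- Cerf's statistic of a subset of `L` is local. [folklore] -/
theorem cerfH_inter_self {L A : Finset V} (hA : A ⊆ L) (p : ℝ) (ω : SiteConfig V) :
    cerfH p (ω ∩ ↑L) A = cerfH p ω A := by
  unfold cerfH
  congr 4
  · ext x
    simp only [Finset.mem_filter, Set.mem_inter_iff, Finset.mem_coe, not_and]
    exact ⟨fun ⟨hx, h⟩ => ⟨hx, fun hω => h hω (hA hx)⟩, fun ⟨hx, h⟩ => ⟨hx, fun hω _ => h hω⟩⟩
  · ext x
    simp only [Finset.mem_filter, Set.mem_inter_iff, Finset.mem_coe]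
    exact ⟨fun ⟨hx, h, _⟩ => ⟨hx, h⟩, fun ⟨hx, h⟩ => ⟨hx, h, hA hx⟩⟩

end Measurability

/-! ### The lattice `ℤ^d`: degrees, the two-arms events -/

section Lattice

/-- Every site of `ℤ^d` has at most `2d` neighbours (they are among the `x ± eᵢ`). [folklore] -/
theorem card_neighborFinset_zdGraph_le (x : Site d) :
    ((zdGraph d).neighborFinset x).card ≤ 2 * d := by
  classical
  have hsub : (zdGraph d).neighborFinset x ⊆ (Finset.univ : Finset (Fin d × Bool)).image
      fun q => if q.2 then x + Pi.single q.1 1 else x - Pi.single q.1 1 := by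
    intro y hy
    rw [SimpleGraph.mem_neighborFinset, zdGraph_adj_iff] at hy
    obtain ⟨i, h | h⟩ := hy
    · exact Finset.mem_image.2 ⟨(i, true), Finset.mem_univ _, by simp [h]⟩
    · exact Finset.mem_image.2 ⟨(i, false), Finset.mem_univ _, by simp [h]⟩
  calc ((zdGraph d).neighborFinset x).card
      ≤ ((Finset.univ : Finset (Fin d × Bool)).image
          fun q => if q.2 then x + Pi.single q.1 1 else x - Pi.single q.1 1).card :=
        Finset.card_le_card hsub
    _ ≤ (Finset.univ : Finset (Fin d × Bool)).card := Finset.card_image_le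
    _ = 2 * d := by simp [Finset.card_univ, mul_comm]

/-- `Λ(n+ℓ) ⊆ x + Λ(2n+ℓ)` for `x ∈ Λ(n)`. [folklore] -/
theorem box_subset_shiftedBox {n ℓ : ℕ} {x : Site d} (hx : x ∈ box d n) :
    box d (n + ℓ) ⊆ shiftedBox x (2 * n + ℓ) := by
  intro t ht
  rw [mem_shiftedBox_iff, mem_box]
  rw [mem_box] at ht hx
  intro i
  have h1 := ht i
  have h2 := hx i
  simp only [Pi.sub_apply]
  push_cast at h1 ⊢
  omega

open Classical in
/-- **`two-arms(x, 2n+ℓ) ⊆ {x ∈ H}` for `x ∈ Λ(n)`, `ℓ ≥ 1`** (Cerf 2015, p. 9: "If `x` belongs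
to `Λ(n)` and the event two-arms`(x, 2n+ℓ)` occurs, then `x` belongs to `H` as well"), for
the repaired collection `𝒞` of clusters of `Λ(n+ℓ)` meeting `Λ(n+1)`: `x` is closed and the
clusters in `Λ(n+ℓ)` of the two neighbours are two distinct members of `𝒞` with `x` in their
closure. [cite: Cerf2015, §5 (p. 9)] -/
theorem siteTwoArms_subset_H {n ℓ : ℕ} (hℓ : 1 ≤ ℓ) {x : Site d} (hx : x ∈ box d n)
    {ω : SiteConfig (Site d)} (hω : ω ∈ siteTwoArms d x (2 * n + ℓ)) :
    x ∉ ω ∧ 2 ≤ ((reachingClusters (zdGraph d) (box d (n + ℓ)) (box d (n + 1)) ω).filter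
      (fun C => x ∈ C ∨ ∃ z ∈ C, (zdGraph d).Adj z x)).card := by
  obtain ⟨y, z, hy, hz, hdisj, ⟨wy, hwy, hwy'⟩, ⟨wz, hwz, hwz'⟩⟩ := hω
  set S := shiftedBox x (2 * n + ℓ) with hS
  set L := box d (n + ℓ) with hL
  have hLS : L ⊆ S := box_subset_shiftedBox hx
  have hLS' : (↑L : Set (Site d)) ⊆ ↑S := Finset.coe_subset.2 hLS
  have h1L : box d (n + 1) ⊆ L := box_mono d (by omega)
  have hnbr : ∀ {v}, (zdGraph d).Adj x v → v ∈ box d (n + 1) := fun hv =>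
    shiftedBox_subset_box hx (mem_shiftedBox_of_adj le_rfl hv)
  have hyL : y ∈ L := h1L (hnbr hy)
  have hzL : z ∈ L := h1L (hnbr hz)
  have hxS : (x : Site d) ∈ (↑S : Set (Site d)) :=
    hLS' (Finset.mem_coe.2 (box_mono d (by omega) hx))
  have hyω : y ∈ ω := (mem_open_of_mem_siteClusterIn (root_mem_siteClusterIn hwy')).1
  have hzω : z ∈ ω := (mem_open_of_mem_siteClusterIn (root_mem_siteClusterIn hwz')).1
  have hyS : y ∈ (↑S : Set (Site d)) :=
    (mem_open_of_mem_siteClusterIn (root_mem_siteClusterIn hwy')).2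
  have hzS : z ∈ (↑S : Set (Site d)) :=
    (mem_open_of_mem_siteClusterIn (root_mem_siteClusterIn hwz')).2
  -- `x` is closed
  have hxω : x ∉ ω := by
    intro hxω
    have h1 : ω ∈ siteConnIn (zdGraph d) ↑S y x := mem_siteConnIn_of_adj _ hyω hxω hyS hxS hy.symm
    have h2 : ω ∈ siteConnIn (zdGraph d) ↑S x z := mem_siteConnIn_of_adj _ hxω hzω hxS hzS hz
    have hzy : z ∈ siteClusterIn (zdGraph d) ↑S ω y :=
      siteConnIn_trans _ subset_rfl subset_rfl h1 h2
    exact Set.disjoint_left.1 hdisj hzy (root_mem_siteClusterIn hwz')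
  refine ⟨hxω, ?_⟩
  -- the two clusters in `L`
  set Cy := L.filter (fun t => t ∈ siteClusterIn (zdGraph d) ↑L ω y) with hCy
  set Cz := L.filter (fun t => t ∈ siteClusterIn (zdGraph d) ↑L ω z) with hCz
  have hry := exists_innerBoundary_siteConnIn_of_subset hLS hyL hwy hwy'
  have hrz := exists_innerBoundary_siteConnIn_of_subset hLS hzL hwz hwz'
  have hCy𝒞 : Cy ∈ reachingClusters (zdGraph d) L (box d (n + 1)) ω :=
    filter_mem_reachingClusters (hnbr hy) hry
  have hCz𝒞 : Cz ∈ reachingClusters (zdGraph d) L (box d (n + 1)) ω :=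
    filter_mem_reachingClusters (hnbr hz) hrz
  have hyCy : y ∈ Cy := Finset.mem_filter.2 ⟨hyL, (mem_siteClusterIn_self_iff _ _ ω y).2
    ⟨hyω, Finset.mem_coe.2 hyL⟩⟩
  have hzCz : z ∈ Cz := Finset.mem_filter.2 ⟨hzL, (mem_siteClusterIn_self_iff _ _ ω z).2
    ⟨hzω, Finset.mem_coe.2 hzL⟩⟩
  have hne : Cy ≠ Cz := by
    intro heq
    have hyCz : y ∈ Cz := heq ▸ hyCy
    have hy1 : y ∈ siteClusterIn (zdGraph d) ↑S ω z :=
      siteConnIn_mono _ hLS' z y (Finset.mem_filter.1 hyCz).2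
    have hy2 : y ∈ siteClusterIn (zdGraph d) ↑S ω y :=
      (mem_siteClusterIn_self_iff _ _ ω y).2 ⟨hyω, hyS⟩
    exact Set.disjoint_left.1 hdisj hy2 hy1
  rw [show (2 : ℕ) = 1 + 1 from rfl, Nat.add_one_le_iff, Finset.one_lt_card]
  exact ⟨Cy, Finset.mem_filter.2 ⟨hCy𝒞, Or.inr ⟨y, hyCy, hy.symm⟩⟩, Cz,
    Finset.mem_filter.2 ⟨hCz𝒞, Or.inr ⟨z, hzCz, hz.symm⟩⟩, hne⟩

/-- **Translation invariance**: `P_p(two-arms(0, m)) ≤ P_p(two-arms(x, m))` (with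
`real_siteTwoArms_le_zero`, equality; Cerf 2015, p. 9, taking expectations of
`|H| ≥ Σ_x 𝟙_{two-arms(x,2n+ℓ)}`). [cite: Cerf2015, §5 (p. 9)] -/
theorem real_siteTwoArms_zero_le (p : unitInterval) (x : Site d) (m : ℕ) :
    (sitePercolation (Site d) p).real (siteTwoArms d 0 m) ≤
      (sitePercolation (Site d) p).real (siteTwoArms d x m) := by
  have hsub : siteTwoArms d 0 m ⊆
      SiteConfig.relabel (zdShiftIso x).toEquiv ⁻¹' siteTwoArms d x m := by
    intro ω hω
    have := relabel_mem_siteTwoArms_shift (v := x) hω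
    rwa [zero_add] at this
  calc (sitePercolation (Site d) p).real (siteTwoArms d 0 m)
      ≤ (sitePercolation (Site d) p).real
          (SiteConfig.relabel (zdShiftIso x).toEquiv ⁻¹' siteTwoArms d x m) :=
        measureReal_mono hsub (measure_ne_top _ _)
    _ = (sitePercolation (Site d) p).real (siteTwoArms d x m) :=
        sitePercolation_real_preimage_relabel _ p _

open Classical in
/-- **`P(ℰᶜ)` by Proposition 4.1** (Cerf 2015, p. 9: "`P(ℰᶜ) ≤ … ≤ |Λ(n)|² 2 exp(−2 (ln n)² p²
(1−p)²)`", here with `|Λ(n+1)| |Λ(n)|` for the repaired `𝒞`): every member of `𝒞` is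
`C_L(x')` for some `x' ∈ Λ(n+1)`, its closure trace is `clusterClosureIn … x'`, and one sums
Prop. 4.1 (with `t = (ln n)√k`) over `x'` and `k = |C̄ ∩ Λ(n)| ∈ [1, |Λ(n)|]`.
[cite: Cerf2015, §5 (p. 9)] -/
theorem real_bad_le (h41 : Cerf2015_prop_4_1) (p : unitInterval) (hp0 : 0 < (p : ℝ))
    (hp1 : (p : ℝ) < 1) {n ℓ : ℕ} (hn : 1 ≤ n) (hℓ : 1 ≤ ℓ) :
    (sitePercolation (Site d) p).real {ω | ∃ C ∈ reachingClusters (zdGraph d) (box d (n + ℓ))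
        (box d (n + 1)) ω,
      ((box d n).filter fun y => y ∈ C ∨ ∃ z ∈ C, (zdGraph d).Adj z y).card ≠ 0 ∧
        Real.log n *
            Real.sqrt ((box d n).filter fun y => y ∈ C ∨ ∃ z ∈ C, (zdGraph d).Adj z y).card ≤
          |cerfH p ω ((box d n).filter fun y => y ∈ C ∨ ∃ z ∈ C, (zdGraph d).Adj z y)|} ≤
      (box d (n + 1)).card * (box d n).card *
        (2 * Real.exp (-2 * Real.log n ^ 2 * (p : ℝ) ^ 2 * (1 - p) ^ 2)) := by
  set μ := sitePercolation (Site d) p with hμ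
  set L := box d (n + ℓ) with hL
  set E : Site d → ℕ → Set (SiteConfig (Site d)) := fun x' k =>
    {ω | Real.log n * Real.sqrt k ≤ |cerfH p ω (clusterClosureIn (zdGraph d) L (box d n) ω x')| ∧
      (clusterClosureIn (zdGraph d) L (box d n) ω x').card = k} with hE
  have hsub : {ω | ∃ C ∈ reachingClusters (zdGraph d) L (box d (n + 1)) ω,
      ((box d n).filter fun y => y ∈ C ∨ ∃ z ∈ C, (zdGraph d).Adj z y).card ≠ 0 ∧
        Real.log n *
            Real.sqrt ((box d n).filter fun y => y ∈ C ∨ ∃ z ∈ C, (zdGraph d).Adj z y).card ≤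
          |cerfH p ω ((box d n).filter fun y => y ∈ C ∨ ∃ z ∈ C, (zdGraph d).Adj z y)|} ⊆
      ⋃ x' ∈ box d (n + 1), ⋃ k ∈ Finset.Icc 1 (box d n).card, E x' k := by
    intro ω hω
    obtain ⟨C, hC, hK, hh⟩ := hω
    obtain ⟨x', hx', -, rfl⟩ := mem_reachingClusters_iff.1 hC
    rw [filter_closure_filter_eq_clusterClosureIn] at hK hh
    simp only [Set.mem_iUnion, exists_prop]
    refine ⟨x', hx', (clusterClosureIn (zdGraph d) L (box d n) ω x').card,
      Finset.mem_Icc.2 ⟨Nat.one_le_iff_ne_zero.2 hK, ?_⟩, hh, rfl⟩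
    exact Finset.card_filter_le _ _
  have hterm : ∀ x' ∈ box d (n + 1), ∀ k ∈ Finset.Icc 1 (box d n).card,
      μ.real (E x' k) ≤ 2 * Real.exp (-2 * Real.log n ^ 2 * (p : ℝ) ^ 2 * (1 - p) ^ 2) := by
    intro x' hx' k hk
    have hk1 : 1 ≤ k := (Finset.mem_Icc.1 hk).1
    have hx'L : x' ∈ box d (n + ℓ) := box_mono d (by omega) hx'
    have ht : 0 ≤ Real.log n * Real.sqrt k :=
      mul_nonneg (Real.log_nonneg (by exact_mod_cast hn)) (Real.sqrt_nonneg _)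
    have h := h41 d p hp0 hp1 n ℓ hn x' hx'L k hk1 (Real.log n * Real.sqrt k) ht
    have hexp : -2 * (p : ℝ) ^ 2 * (1 - p) ^ 2 * (Real.log n * Real.sqrt k) ^ 2 / k =
        -2 * Real.log n ^ 2 * (p : ℝ) ^ 2 * (1 - p) ^ 2 := by
      have hk0 : (0 : ℝ) < k := by exact_mod_cast hk1
      rw [mul_pow, Real.sq_sqrt hk0.le]
      field_simp
    rw [hexp] at h
    exact h
  calc μ.real _ ≤ μ.real (⋃ x' ∈ box d (n + 1), ⋃ k ∈ Finset.Icc 1 (box d n).card, E x' k) :=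
        measureReal_mono hsub (measure_ne_top _ _)
    _ ≤ ∑ x' ∈ box d (n + 1), μ.real (⋃ k ∈ Finset.Icc 1 (box d n).card, E x' k) :=
        measureReal_biUnion_finset_le _ _
    _ ≤ ∑ x' ∈ box d (n + 1), ∑ k ∈ Finset.Icc 1 (box d n).card, μ.real (E x' k) :=
        Finset.sum_le_sum fun x' _ => measureReal_biUnion_finset_le _ _
    _ ≤ ∑ x' ∈ box d (n + 1), ∑ k ∈ Finset.Icc 1 (box d n).card,
          2 * Real.exp (-2 * Real.log n ^ 2 * (p : ℝ) ^ 2 * (1 - p) ^ 2) :=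
        Finset.sum_le_sum fun x' hx' => Finset.sum_le_sum fun k hk => hterm x' hx' k hk
    _ = (box d (n + 1)).card * (box d n).card *
          (2 * Real.exp (-2 * Real.log n ^ 2 * (p : ℝ) ^ 2 * (1 - p) ^ 2)) := by
        rw [Finset.sum_const, Finset.sum_const, Nat.card_Icc, nsmul_eq_mul, nsmul_eq_mul]
        simp only [add_tsub_cancel_right]
        ring

end Lattice

/-! ### Lemma 5.1 -/

open Classical in
/-- **Cerf 2015, Lemma 5.1 (the central inequality) from Proposition 4.1**, for the repaired
collection `𝒞` (see the module docstrings here and in `CerfCentralInequality.lean`):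
`P(two-arms(0, 2n+ℓ)) ≤ (2d ln n/√|Λ(n)|) E(√|𝒞|) + (4d/(p(1−p))) |Λ(n+1)|² e^{−2(ln n)² p²(1−p)²}`
for `d ≥ 2`, `0 < p < 1`, `n ≥ 1`, `ℓ ≥ 2`. [cite: Cerf2015, Lem 5.1] -/
theorem Cerf2015_lem_5_1_of_prop_4_1 (h41 : Cerf2015_prop_4_1) : Cerf2015_lem_5_1 := by
  intro d hd p hp0 hp1 n ℓ hn hℓ
  set μ := sitePercolation (Site d) p with hμ
  set L := box d (n + ℓ) with hL
  set Λ1 := box d (n + 1) with hΛ1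
  set Λn := box d n with hΛn
  have hd1 : 1 ≤ d := le_trans one_le_two hd
  have hp1' : 0 < 1 - (p : ℝ) := by linarith
  have hpq : 0 < (p : ℝ) * (1 - p) := mul_pos hp0 hp1'
  have hΛnL : Λn ⊆ L := box_mono d (by omega)
  have hΛn1 : Λn ⊆ Λ1 := box_mono d (by omega)
  have hΛ1L : Λ1 ⊆ L := box_mono d (by omega)
  have hnbr : ∀ x ∈ Λn, ∀ y, (zdGraph d).Adj x y → y ∈ Λ1 := fun x hx y hxy =>
    shiftedBox_subset_box hx (mem_shiftedBox_of_adj le_rfl hxy)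
  set a : ℝ := Real.log n with ha
  have ha0 : 0 ≤ a := Real.log_nonneg (by exact_mod_cast hn)
  -- the functionals
  set 𝒞 : SiteConfig (Site d) → Finset (Finset (Site d)) := fun ω =>
    reachingClusters (zdGraph d) L Λ1 ω with h𝒞
  set m : Site d → SiteConfig (Site d) → ℕ := fun x ω =>
    ((𝒞 ω).filter (fun C => x ∈ C ∨ ∃ z ∈ C, (zdGraph d).Adj z x)).card with hm
  set PH : Site d → SiteConfig (Site d) → Prop := fun x ω => x ∉ ω ∧ 2 ≤ m x ω with hPH
  set PG : Site d → SiteConfig (Site d) → Prop := fun x ω => x ∉ ω ∧ 1 ≤ m x ω with hPG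
  set PF : Site d → SiteConfig (Site d) → Prop := fun x ω =>
    x ∈ ω ∧ ∃ w ∈ innerBoundary (zdGraph d) L, w ∈ siteClusterIn (zdGraph d) ↑L ω x with hPF
  set N : Site d → Set (SiteConfig (Site d)) := fun x => {ω | ∃ y, (zdGraph d).Adj x y ∧
    ∃ w ∈ innerBoundary (zdGraph d) L, ω ∈ siteConnIn (zdGraph d) ↑(L.erase x) y w} with hN
  set bad : SiteConfig (Site d) → Prop := fun ω => ∃ C ∈ 𝒞 ω,
    (Λn.filter fun y => y ∈ C ∨ ∃ z ∈ C, (zdGraph d).Adj z y).card ≠ 0 ∧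
      a * Real.sqrt ((Λn.filter fun y => y ∈ C ∨ ∃ z ∈ C, (zdGraph d).Adj z y).card) ≤
        |cerfH p ω (Λn.filter fun y => y ∈ C ∨ ∃ z ∈ C, (zdGraph d).Adj z y)| with hbad
  set D2 : ℕ := 2 * d with hD2
  set Ψ : SiteConfig (Site d) → ℝ := fun ω => (1 - p) * (a * Real.sqrt (D2 * Λn.card) *
    Real.sqrt (𝒞 ω).card + D2 * Λn.card / (p * (1 - p)) * (if bad ω then 1 else 0)) with hΨ
  -- multiplicities are at most `2d`
  have hMult : ∀ ω, ∀ x ∈ Λn, m x ω ≤ D2 := fun ω x hx =>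
    (card_filter_closure_le (hΛnL hx)).trans (max_le (by omega) (card_neighborFinset_zdGraph_le x))
  -- the pointwise inequality
  have hpt : ∀ ω, (∑ x ∈ Λn, (if PH x ω then (1 : ℝ) else 0)) +
      (∑ x ∈ Λn, (if PG x ω then (1 : ℝ) else 0)) -
      (1 - p) / p * (∑ x ∈ Λn, (if PF x ω then (1 : ℝ) else 0)) ≤ Ψ ω := by
    intro ω
    have h3 : ∑ x ∈ Λn, (if PF x ω then (1 : ℝ) else 0) =
        ∑ x ∈ Λn, (((𝒞 ω).filter (fun C => x ∈ C)).card : ℝ) :=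
      Finset.sum_congr rfl fun x hx => (card_filter_mem_reachingClusters hΛ1L (hΛn1 hx)).symm
    rw [h3]
    refine (counting_le hΛnL ω hp0.ne' hp1'.ne').trans ?_
    refine mul_le_mul_of_nonneg_left ?_ hp1'.le
    refine le_trans (Finset.sum_le_sum fun C _ => le_abs_self _) ?_
    exact sum_abs_cerfH_le hΛnL ω hp0 hp1 ha0 (hMult ω)
  -- locality of the functionals
  have hxL : ∀ {x}, x ∈ Λn → ∀ ω : SiteConfig (Site d), (x ∈ ω ∩ (↑L : Set (Site d)) ↔ x ∈ ω) :=
    fun hx ω => ⟨fun h => h.1, fun h => ⟨h, Finset.mem_coe.2 (hΛnL hx)⟩⟩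
  have hmloc : ∀ x ω, m x (ω ∩ ↑L) = m x ω := by
    intro x ω; simp only [hm, h𝒞, reachingClusters_inter_self]
  have hPHloc : ∀ x ∈ Λn, ∀ ω, PH x (ω ∩ ↑L) ↔ PH x ω := by
    intro x hx ω; simp only [hPH, hmloc, hxL hx]
  have hPGloc : ∀ x ∈ Λn, ∀ ω, PG x (ω ∩ ↑L) ↔ PG x ω := by
    intro x hx ω; simp only [hPG, hmloc, hxL hx]
  have hPFloc : ∀ x ∈ Λn, ∀ ω, PF x (ω ∩ ↑L) ↔ PF x ω := by
    intro x hx ω; simp only [hPF, siteClusterIn_inter_self, hxL hx]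
  have hcl : ∀ (ω : SiteConfig (Site d)) (q : Site d → Prop) (inst : DecidablePred q),
      cerfH p (ω ∩ ↑L) (@Finset.filter _ q inst Λn) = cerfH p ω (@Finset.filter _ q inst Λn) :=
    fun ω q inst => cerfH_inter_self ((Finset.filter_subset _ _).trans hΛnL) p ω
  have hbadloc : ∀ ω, bad (ω ∩ ↑L) ↔ bad ω := by
    intro ω; simp only [hbad, h𝒞, reachingClusters_inter_self, hcl]
  -- integrability
  have hiH : ∀ x ∈ Λn, Integrable (fun ω => if PH x ω then (1 : ℝ) else 0) μ :=
    fun x hx => integrable_ite p L (hPHloc x hx)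
  have hiG : ∀ x ∈ Λn, Integrable (fun ω => if PG x ω then (1 : ℝ) else 0) μ :=
    fun x hx => integrable_ite p L (hPGloc x hx)
  have hiF : ∀ x ∈ Λn, Integrable (fun ω => if PF x ω then (1 : ℝ) else 0) μ :=
    fun x hx => integrable_ite p L (hPFloc x hx)
  have hibad : Integrable (fun ω => if bad ω then (1 : ℝ) else 0) μ := integrable_ite p L hbadloc
  have hNcard : ∀ ω, ((𝒞 ω).card : ℝ) ≤ Λ1.card := fun ω => by
    have : (𝒞 ω).card ≤ Λ1.card := Finset.card_image_le.trans (Finset.card_filter_le _ _)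
    exact_mod_cast this
  have hisqrt : Integrable (fun ω => Real.sqrt (𝒞 ω).card) μ := by
    refine integrable_of_forall_inter_eq p L (fun ω => ?_) (C := Real.sqrt Λ1.card) (fun ω => ?_)
    · simp only [h𝒞, reachingClusters_inter_self]
    · rw [abs_of_nonneg (Real.sqrt_nonneg _)]
      exact Real.sqrt_le_sqrt (hNcard ω)
  have hiΨ1 : Integrable (fun ω => a * Real.sqrt (D2 * Λn.card) * Real.sqrt (𝒞 ω).card) μ :=
    hisqrt.const_mul _
  have hiΨ2 : Integrable (fun ω => (D2 : ℝ) * Λn.card / ((p : ℝ) * (1 - p)) *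
      (if bad ω then (1 : ℝ) else 0)) μ := hibad.const_mul _
  have hiΨ12 : Integrable (fun ω => a * Real.sqrt (D2 * Λn.card) * Real.sqrt (𝒞 ω).card +
      (D2 : ℝ) * Λn.card / ((p : ℝ) * (1 - p)) * (if bad ω then (1 : ℝ) else 0)) μ := hiΨ1.add hiΨ2
  have hiΨ : Integrable Ψ μ := hiΨ12.const_mul _
  have hiHs : Integrable (fun ω => ∑ x ∈ Λn, (if PH x ω then (1 : ℝ) else 0)) μ :=
    integrable_finsetSum _ hiH
  have hiGs : Integrable (fun ω => ∑ x ∈ Λn, (if PG x ω then (1 : ℝ) else 0)) μ :=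
    integrable_finsetSum _ hiG
  have hiFs : Integrable (fun ω => ∑ x ∈ Λn, (if PF x ω then (1 : ℝ) else 0)) μ :=
    integrable_finsetSum _ hiF
  have hiHG : Integrable (fun ω => (∑ x ∈ Λn, (if PH x ω then (1 : ℝ) else 0)) +
      (∑ x ∈ Λn, (if PG x ω then (1 : ℝ) else 0))) μ := hiHs.add hiGs
  have hiFc : Integrable (fun ω => (1 - p) / p * (∑ x ∈ Λn, (if PF x ω then (1 : ℝ) else 0))) μ :=
    hiFs.const_mul _
  have hiΦ : Integrable (fun ω => (∑ x ∈ Λn, (if PH x ω then (1 : ℝ) else 0)) +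
      (∑ x ∈ Λn, (if PG x ω then (1 : ℝ) else 0)) -
      (1 - p) / p * (∑ x ∈ Λn, (if PF x ω then (1 : ℝ) else 0))) μ := hiHG.sub hiFc
  -- integrate
  have hint := integral_mono hiΦ hiΨ hpt
  rw [integral_sub hiHG hiFc, integral_add hiHs hiGs, integral_const_mul, integral_finsetSum _ hiH,
      integral_finsetSum _ hiG, integral_finsetSum _ hiF] at hint
  simp only [hΨ] at hint
  rw [integral_const_mul, integral_add hiΨ1 hiΨ2, integral_const_mul, integral_const_mul] at hint
  rw [Finset.sum_congr rfl fun x hx => integral_ite_eq_real p L (hPHloc x hx),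
    Finset.sum_congr rfl fun x hx => integral_ite_eq_real p L (hPGloc x hx),
    Finset.sum_congr rfl fun x hx => integral_ite_eq_real p L (hPFloc x hx),
    integral_ite_eq_real p L hbadloc] at hint
  -- the `F` and `G` terms cancel
  have hG : ∀ x ∈ Λn, μ.real {ω | PG x ω} = (1 - p) * μ.real (N x) := by
    intro x hx
    have hset : {ω | PG x ω} = {ω | x ∉ ω} ∩ N x := by
      ext ω
      simp only [hPG, hN, Set.mem_setOf_eq, Set.mem_inter_iff]
      rw [← closed_mem_closure_iff (hnbr x hx) ω, Nat.one_le_iff_ne_zero, hm]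
      simp only [ne_eq, Finset.card_eq_zero, Finset.filter_eq_empty_iff, not_forall, not_not,
        exists_prop]
      exact Iff.rfl
    rw [hset]
    exact real_closed_inter_eq p L x
  have hF : ∀ x ∈ Λn, μ.real {ω | PF x ω} = p * μ.real (N x) := by
    intro x hx
    have hset : {ω | PF x ω} = {ω | x ∈ ω} ∩ N x := by
      ext ω
      simp only [hPF, hN, Set.mem_setOf_eq, Set.mem_inter_iff]
      exact open_reaches_iff (hΛnL hx) (fun y hy => hΛ1L (hnbr x hx y hy)) ω
    rw [hset]
    exact real_open_inter_eq p L x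
  have hcancel : ∑ x ∈ Λn, μ.real {ω | PG x ω} -
      (1 - p) / p * ∑ x ∈ Λn, μ.real {ω | PF x ω} = 0 := by
    rw [Finset.mul_sum, ← Finset.sum_sub_distrib]
    refine Finset.sum_eq_zero fun x hx => ?_
    rw [hG x hx, hF x hx]
    field_simp
    ring
  -- the `H` term dominates the two-arms probability
  have hH : (Λn.card : ℝ) * μ.real (siteTwoArms d 0 (2 * n + ℓ)) ≤
      ∑ x ∈ Λn, μ.real {ω | PH x ω} := by
    have : ∀ x ∈ Λn, μ.real (siteTwoArms d 0 (2 * n + ℓ)) ≤ μ.real {ω | PH x ω} := by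
      intro x hx
      refine (real_siteTwoArms_zero_le p x _).trans
        (measureReal_mono (fun ω hω => ?_) (measure_ne_top _ _))
      exact siteTwoArms_subset_H (by omega) hx hω
    calc (Λn.card : ℝ) * μ.real (siteTwoArms d 0 (2 * n + ℓ))
        = ∑ x ∈ Λn, μ.real (siteTwoArms d 0 (2 * n + ℓ)) := by
          rw [Finset.sum_const, nsmul_eq_mul]
      _ ≤ _ := Finset.sum_le_sum this
  -- the bad event
  have hB : μ.real {ω | bad ω} ≤ Λ1.card * Λn.card *
      (2 * Real.exp (-2 * Real.log n ^ 2 * (p : ℝ) ^ 2 * (1 - p) ^ 2)) :=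
    real_bad_le h41 p hp0 hp1 hn (by omega)
  -- arithmetic
  set T := μ.real (siteTwoArms d 0 (2 * n + ℓ)) with hT
  set I := ∫ ω, Real.sqrt (𝒞 ω).card ∂μ with hI
  set B := μ.real {ω | bad ω} with hBdef
  set ex := Real.exp (-2 * Real.log n ^ 2 * (p : ℝ) ^ 2 * (1 - p) ^ 2) with hex
  set cn : ℝ := (Λn.card : ℝ) with hcn
  set c1 : ℝ := (Λ1.card : ℝ) with hc1
  have hI0 : 0 ≤ I := integral_nonneg fun ω => Real.sqrt_nonneg _
  have hB0 : 0 ≤ B := measureReal_nonneg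
  have hex0 : 0 ≤ ex := Real.exp_nonneg _
  have hcn1 : 1 ≤ cn := by
    rw [hcn, hΛn, card_box]; exact_mod_cast Nat.one_le_pow _ _ (by omega)
  have hcn0 : 0 < cn := by linarith
  have hcnc1 : cn ≤ c1 := by rw [hcn, hc1]; exact_mod_cast Finset.card_le_card hΛn1
  have hD2 : (D2 : ℝ) = 2 * d := by rw [hD2]; push_cast; ring
  have hmain : cn * T ≤ (1 - p) * a * Real.sqrt (2 * d * cn) * I + 2 * d * cn / p * B := by
    have h := hH.trans (by linarith [hint, hcancel] : ∑ x ∈ Λn, μ.real {ω | PH x ω} ≤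
      (1 - p) * (a * Real.sqrt (D2 * Λn.card) * I + D2 * Λn.card / (p * (1 - p)) * B))
    rw [hD2] at h
    have e : (1 - (p : ℝ)) * (a * Real.sqrt (2 * d * cn) * I + 2 * d * cn / (p * (1 - p)) * B) =
        (1 - p) * a * Real.sqrt (2 * d * cn) * I + 2 * d * cn / p * B := by
      field_simp
    rw [← e]; exact h
  clear_value T I B ex cn c1
  clear hint hcancel hH hpt hiΦ hiFc hiHG hiFs hiGs hiHs hiΨ hiΨ12 hiΨ2 hiΨ1 hisqrt hibad hiF
    hiG hiH
  -- first term
  set r := Real.sqrt cn with hr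
  have hr0 : 0 < r := Real.sqrt_pos.2 hcn0
  have hrr : r * r = cn := Real.mul_self_sqrt hcn0.le
  have hsq : Real.sqrt (2 * d * cn) = Real.sqrt (2 * d) * r := by
    rw [hr, ← Real.sqrt_mul (by positivity)]
  have h2d : (1 - (p : ℝ)) * Real.sqrt (2 * d) ≤ 2 * d := by
    have h1 : Real.sqrt (2 * d) ≤ 2 * d := by
      rw [Real.sqrt_le_left (by positivity)]
      have : (2 : ℝ) ≤ 2 * d := by
        have : (1 : ℝ) ≤ d := by exact_mod_cast hd1
        linarith
      nlinarith
    have h2 : 0 ≤ Real.sqrt (2 * (d : ℝ)) := Real.sqrt_nonneg _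
    nlinarith [hp0]
  have hT1 : (1 - p) * a * Real.sqrt (2 * d * cn) * I / cn ≤ 2 * d * a / r * I := by
    rw [hsq, ← hrr]
    have e : (1 - (p : ℝ)) * a * (Real.sqrt (2 * d) * r) * I / (r * r) =
        ((1 - p) * Real.sqrt (2 * d)) * (a / r * I) := by
      field_simp
    rw [e, show 2 * (d : ℝ) * a / r * I = (2 * d) * (a / r * I) by ring]
    exact mul_le_mul_of_nonneg_right h2d (by positivity)
  -- second term
  have hT2 : 2 * d * cn / p * B / cn ≤ 4 * d / (p * (1 - p)) * c1 ^ 2 * ex := by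
    have e : 2 * (d : ℝ) * cn / p * B / cn = 2 * d / p * B := by
      field_simp
    rw [e]
    have hc10 : 0 ≤ c1 := le_trans hcn0.le hcnc1
    calc 2 * (d : ℝ) / p * B ≤ 2 * d / p * (c1 * cn * (2 * ex)) :=
          mul_le_mul_of_nonneg_left hB (by positivity)
      _ = 4 * d * c1 * ex * (cn / p) := by ring
      _ ≤ 4 * d * c1 * ex * (c1 / (p * (1 - p))) := by
          refine mul_le_mul_of_nonneg_left ?_ (by positivity)
          rw [div_le_div_iff₀ hp0 hpq]
          have hp1'' : (1 - (p : ℝ)) ≤ 1 := by linarith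
          nlinarith [mul_le_mul hcnc1 hp1'' hp1'.le hc10]
      _ = 4 * d / (p * (1 - p)) * c1 ^ 2 * ex := by ring
  -- conclusion
  have hfin : T ≤ ((1 - p) * a * Real.sqrt (2 * d * cn) * I + 2 * d * cn / p * B) / cn := by
    rw [le_div_iff₀ hcn0, mul_comm]; exact hmain
  calc T ≤ ((1 - p) * a * Real.sqrt (2 * d * cn) * I + 2 * d * cn / p * B) / cn := hfin
    _ = (1 - p) * a * Real.sqrt (2 * d * cn) * I / cn + 2 * d * cn / p * B / cn := add_div _ _ _
    _ ≤ 2 * d * a / r * I + 4 * d / (p * (1 - p)) * c1 ^ 2 * ex := add_le_add hT1 hT2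

end CritPerc

end Literature.Probability.Percolation
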